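import Mathlib
import Literature.MathematicalPhysics.QuantumFieldTheory.Balaban1983to89.B2

/-!
# `Balaban1983to89.B2Sect3C` — [Balaban1982Higgs2] Sect. 3.C pp. 592–594: the geometric / combinatorial displays
(3.43)–(3.52) TYPED VERBATIM, their counting and summation halves KERNEL-CHECKED, and the printed conclusion
"(3.42) ⇐ (3.47) ∧ (3.50)/(3.52) ∧ [2p ≥ (d+1)r, ε₀ small]" KERNEL-CHECKED over the carrier of `…Balaban1983to89.B2`

CITATION HEADER (lean-in-tree rule 2026-08-18).  Source: T. Bałaban, *(Higgs)₂,₃ quantum fields in a finite volume.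
II. An upper bound*, Commun. Math. Phys. **86**, 555–594 (1982), doi 10.1007/bf01214890 (cell INDEX B2, a CONTEXT
paper of the series B1–B16; held: `paper:balaban1982-cmp86-higgs23-ii`; journal page = PDF page + 554).  Every
quotation below is read from the page renders `HOME/b2b-balaban-ref1/pages/1982-cmp86-higgs23-II/…-p038, p039,
p040-x2.png` (journal pp. 592, 593, 594), with pp. 566 [p012] ("admissible"), 582 [p028] (stopping rule, (2.117)),
591 [p037] ((3.40)) for the meaning of the symbols.  This module is a SIBLING of `…Balaban1983to89.B2` (unit pv04:
`Params`, `Run`, `lhs342`, `Ineq342With`, `Claim342Printed`, and the arithmetic of (3.46), (3.53), (3.54); unit pv07: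
Prop. 3.1, (2.28)) and modifies nothing there: it imports that module and supplies what its header lists as NOT
reproduced — *"the geometric covering statements (3.43)–(3.45), (3.48)–(3.52) … and the counting step (3.46) ⇒ (3.47)"*.
WHY: the passage is cited BY NUMBER as a model-independent black box twice in the audited series — B10 =
[Balaban1985UV3] pp. 273–274 *"The analysis of Sect. 3.C [9], which is model independent, show that these small
factors are enough to control all sums in (41)"* ((41) p. 266 carrying the volume terms `Σ_j O(log g_j⁻¹)|Z_j|`; cell
GAPS.md G-adv2-7, G-B10-02) and B14 = [Balaban1988Convergent] p. 264, the paragraph immediately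
preceding Corollary 3 (2.50): *"the combinatorics now is the same,
relative to the η-scale of the lattice T_η, as in [6], hence we have the same result for this scale"* (cell GAPS.md
G-adv3-1; typed consumer `…Balaban1983to89.B14Cor3`, leaf U2) — so the cell needs the SHAPE of what Sect. 3.C proves,
with every input named.  p. 592: *"C. The Combinatorial Estimate.  In this section we will prove the inequality (3.42).
The proof is purely combinatoric and model-independent. At first we introduce the quantities which we will use later to
express all the other quantities."*

WHAT IS REPRODUCED (statement level; the printed text of (3.43)–(3.54) is quoted in full in the section docstring of
`…Balaban1983to89.B2` and at each declaration below):
(1) (3.43)–(3.45) p. 592 — the cube families 𝒞_k and `|𝒞_k| ≤ 3ᵈ(|P_v⁽ᵏ⁾| + … + |R_s⁽ᵏ⁾|)`.  KERNEL-CHECKED in an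
explicit model (ℝᵈ partitioned into half-open cubes `Π_i [a_i s, (a_i+1)s)`, `a ∈ ℤᵈ`; the elements of P_v ∪ … ∪ R_s as
points; sup-distance): a cube of side `s` within distance `t < s` of a point is among the `3ᵈ` cubes around the point's
cube (`near_mem_nbhd` — the printed *"we assign a cube □ having a common point with this element and 3ᵈ − 1 cubes
neighbouring with □ … It is so because a distance of each large block contained in Λ₀⁽⁰⁾ᶜ from the set P_v⁽⁰⁾ ∪ … ∪ R_s⁽⁰⁾
is ≤ r(ε)"* with side `> r(ε)`), hence `|𝒞| ≤ 3ᵈ|P_v ∪ … ∪ R_s| ≤ 3ᵈ(|P_v| + … + |R_s|)` (`card_le_three_pow_mul`,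
`card_le_three_pow_mul_six`).
(2) (3.46) p. 593 — each term of (3.41) is `≤ exp(−c₀p(Lᵏε)²|𝒞_k|)` with the printed `c₀ = min{⅛a3⁻ᵈ, ¼γ₀3⁻ᵈ, 3⁻ᵈ}`
(`term341_le`, from `B2.step346_exponent`), the number of 6-tuples of subsets of Λ₀⁽ᵏ⁾ᶜ is `2^{6|Λ₀⁽ᵏ⁾ᶜ|}`
(`card_sixTuples`), so `ζ″_{Λ₀⁽ᵏ⁾} ≤ 2^{6|Λ₀⁽ᵏ⁾ᶜ|} exp(−c₀p(Lᵏε)²|𝒞_k|)` (`ineq346`).  KERNEL-CHECKED.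
(3) (3.47) p. 593 — TYPED as the leaf `Leaf347` (the left side of (3.42), `B2.lhs342`, is `≤ sup` over admissible
sequences of `rhs347` = the three printed exponentials with their O(1)'s named `A`, `B`).  NOT PROVED: it is the output
of the step the print introduces only by the words *"After easy transformations we get"* (p. 593, directly after
(3.46)), a step not displayed in print (cell GAPS.md G-pv04-3 lists what it must do:
absorb the SUM over admissible sequences into a sup, move the factors `O(1)(Lᵏε)^{κ₀}|Λ₇⁽ᵏ⁻¹⁾′ ∩ Λ₇⁽ᵏ⁾ᶜ|`,
`O(1)|Λ₅⁽ᵏ⁻¹⁾′ ∩ Λ₅⁽ᵏ⁾ᶜ|` of (3.42) into *"the expressions dependent on Λ₀⁽ᵏ⁾ᶜ"* with the printed weight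
`(1 + log(Lᵏε)⁻¹)`, and the k = K terms into `exp(O(1)|T₁⁽ᴷ⁾|)`).
(4) (3.48)–(3.50) p. 593 — the corridor construction 𝒟₀, …, 𝒟_{K−1}.  Its COUNTING half is KERNEL-CHECKED
(`card_le_of_cover`: a set covered by the cubes of 𝒟, each with ≤ m points, has ≤ m|𝒟| points; `card_latticeCube`: an
integer-sided cube of side n has nᵈ lattice points); its GEOMETRIC half (corridors *"of thickness > 9r(ε), but
< 10r(ε)"*, cubes of side `< 22r(ε)`, the operation ′ and the rescaling to T₁⁽ᵏ⁾) is TYPED as the leaf `Bound350` =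
the printed cardinality bound (3.50) with its printed coefficients (`coef350`).  NOT PROVED (it is a statement about
the block structure of the lattices T₁⁽ᵏ⁾, which this context module does not model).
(5) (3.51)–(3.52) p. 594 — KERNEL-CHECKED: `r(Lᵏ⁻ʲε) ≤ (1 + j log L)ʳ r(Lᵏε)` (`r_rescale_le`), the series
`Σ_{j≥0} L⁻ʲ(1 + j log L)ʳ` converges (`summable_term351`; its sum is the printed O(1), `S351`), every coefficient of
(3.50) is `≤ 22·S351·r(Lᵏε)` (`coef350_le`), *"hence"* (3.52) `|Λ₀⁽ᵏ⁾ᶜ| ≤ O(1) r(Lᵏε)ᵈ(|𝒞₀| + … + |𝒞_k|)` with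
`O(1) = (22·S351)ᵈ` (`bound352_of_350 : Bound350 → Bound352 _`).
(6) (3.53)–(3.54) p. 594 and *"Thus from (3.47) inequality (3.42) follows"* — KERNEL-CHECKED: `exponent_nonpos` (the
first two exponents of (3.47) sum to ≤ 0, by `B2.sum353_exchange`, `B2.inner353_bound`, `B2.coeff354_nonneg`,
`B2.sum354_nonpos`, given (3.52), `r ≥ 2`, the stopping rule and the per-scale constant condition of (3.54));
`ineq342_of_leaves : Leaf347 → Bound352 → … → B2.Ineq342With P ρ B` (one run; the right-side O(1) of (3.42) IS the
O(1) `B` of the third exponent of (3.47)); and, with the quantifier structure of `B2.Claim342Printed` (threshold ε₁, then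
a constant independent of ε, then every run obeying the stopping rule): `claim342_of_leaves` (STRICT case
`2p > (d+1)r`: *"ε₀ is sufficiently small"* = `ε₀ ≤ min{1, e^{1−x₀}}`, x₀ from `B2.coeff354_threshold`),
`claim342_of_leaves_of_const` (any `2p ≥ (d+1)r` when the constants already comply — the equality case of cell GAPS.md
G-pv04-2), `claim342_of_leaves350` (the same from the leaf (3.50) instead of (3.52)).

THE TYPED READING, in one sentence: Sect. 3.C proves (3.42) for a family of runs EXACTLY IF the unprinted step (3.47)
holds with O(1)'s `A, B` independent of ε and the corridor bound (3.50) holds as printed — everything else on pp.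
592–594 is arithmetic and counting, and is certified here and in `…B2` by the kernel (zero `sorry`), using `r ≥ 2`
(p. 594; (2.7) prints `r > 1`) and either `2p > (d+1)r` or compliant constants.  This is also the precise content a
TRANSFER of "the same combinatorics" to another model (B10 d = 3, B14/B16 d = 4) has to re-establish: the two leaves in
the new setting, with `(1 + log(Lᵏε)⁻¹)` replaced by that model's logarithm (cell GAPS.md G-adv3-1 (2), G-B10-02).

WHAT IS *NOT* REPRODUCED OR ASSERTED: (3.42) itself and the claim of Sect. 3.C (they remain the hypotheses /
conclusions `B2.Ineq342With`, `B2.Claim342Printed`); the two leaves `Leaf347`, `Bound350` (quoted, typed, unproved —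
located in cell GAPS.md G-pv04-3); the identification of the model's sets P_v⁽ᵏ⁾, …, Λ₀⁽ᵏ⁾ᶜ, 𝒞_k, 𝒟_k with the abstract
data (`CData` is pure data, like `B2.Run`); the torus identifications (which only lower the counts in (1), (4)); the
extended (non-point) elements of Q_v, R_v, … (for an element of diameter δ the count (1) holds with `t + δ < s`, or
with 5ᵈ in place of 3ᵈ — immaterial for (3.46), where only `c₀ > 0` matters; cell DIVERGENCE.md D-pv04.3, which also
records the d-th power the print drops in the middle expression of (3.51) and the misprint "(3.43)" for "(3.53)" on
p. 594).  NOTHING of the series is asserted; value = typed skeleton + located gaps, NOT summit progress.  Unit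
`b2b-balaban-pv04` (surge node prover #04, gen 2; cell LEMMAS.md PHASE-2 row P00 "sharpen"); companion rows: cell
GAPS.md G-pv04-2, G-pv04-3 (objections, located), C-pv04-1, C-pv04-2 (certifications), DIVERGENCE.md D-pv04.2, D-pv04.3.
REVISION v1.1 (DOCSTRING-ONLY; cross-read of v1 by unit pv18, cell GAPS.md C-pv18-2 / G-pv18-2): the quotations in item (3)
above and at `Near`, `Leaf347` re-keyed word for word from the renders p038/p039 (v1 carried paraphrases inside quotation
marks; the typed content was and is unaffected), two further fragments re-keyed after a sweep of every quotation-marked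
passage of the module against the renders p038–p040 ("ε₀ is sufficiently small"; the B14 p. 264 locator); every
declaration byte-identical to v1.
-/

namespace Literature.MathematicalPhysics.QuantumFieldTheory.Balaban1983to89.B2Sect3C

open Finset
open Literature.MathematicalPhysics.QuantumFieldTheory.Balaban1983to89
open Literature.MathematicalPhysics.QuantumFieldTheory.Balaban1983to89.B2

/-! ## 1. (3.43)–(3.45) p. 592 and (3.48) p. 593: the two counting facts about cubes -/

section Cubes

variable {d : ℕ}

/-- The half-open cube of side `s` with index `a ∈ ℤᵈ` in a regular partition of ℝᵈ ⊃ the lattice: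
`□_a = Π_i [a_i s, (a_i + 1) s)`.  p. 592: *"Let us consider a regular partition of T₁ into a lattice of cubes, each
cube is a sum of large blocks and a length of its side is bigger r(ε), and less 2r(ε)."* (modelled in ℝᵈ; on the
torus cubes are identified, which can only lower the counts below). [cite: Balaban1982Higgs2, p.592] -/
def cube (s : ℝ) (a : Fin d → ℤ) : Set (Fin d → ℝ) :=
  {y | ∀ i, (a i : ℝ) * s ≤ y i ∧ y i < ((a i : ℝ) + 1) * s}

/-- `Near s t x a`: the cube `□_a` (side `s`) has a point at sup-distance `≤ t` from the point `x`.  This is how the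
module types the premise of the two printed covering sentences of p. 592 — (k = 0) *"It is so because a distance of
each large block contained in Λ₀⁽⁰⁾ᶜ from the set P_v⁽⁰⁾ ∪ … ∪ R_s⁽⁰⁾ is ≤ r(ε)"* and (k ≥ 1) *"Because each large
block of the lattice T₁⁽ᵏ⁾ contained in Λ₀⁽ᵏ⁾ᶜ and having common points with Λ₇⁽ᵏ⁻¹⁾′ has the distance from the set
P_v⁽ᵏ⁾ ∪ … ∪ R_s⁽ᵏ⁾ less than or equal to r(Lᵏε)"* (the print's reason why the 3ᵈ cubes around the elements cover
∪𝒞₀, resp. ∪𝒞_k) — per cube: the cube has a point within sup-distance `t` (= r(ε), resp. r(Lᵏε)) of an element, the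
elements being modelled as points of ℝᵈ and the counting theorems below assuming `t < s` (cell DIVERGENCE.md
D-pv04.3; v1.1 re-quotation from render p038, cell GAPS.md G-pv18-2). [cite: Balaban1982Higgs2, p.592] -/
def Near (s t : ℝ) (x : Fin d → ℝ) (a : Fin d → ℤ) : Prop :=
  ∃ y ∈ cube s a, ∀ i, |y i - x i| ≤ t

/-- The `3ᵈ` cube indices around the cube containing `x`: p. 592 *"we assign a cube □ having a common point with this
element and 3ᵈ − 1 cubes neighbouring with □"*. [cite: Balaban1982Higgs2, p.592] -/
noncomputable def nbhd (s : ℝ) (x : Fin d → ℝ) : Finset (Fin d → ℤ) :=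
  Fintype.piFinset fun i => ({⌊x i / s⌋ - 1, ⌊x i / s⌋, ⌊x i / s⌋ + 1} : Finset ℤ)

/-- `|nbhd| ≤ 3ᵈ`. [folklore: product of three-element sets, cite: Balaban1982Higgs2, p.592] -/
theorem card_nbhd_le (s : ℝ) (x : Fin d → ℝ) : (nbhd s x).card ≤ 3 ^ d := by
  unfold nbhd
  rw [Fintype.card_piFinset]
  calc ∏ i, ({⌊x i / s⌋ - 1, ⌊x i / s⌋, ⌊x i / s⌋ + 1} : Finset ℤ).card ≤ ∏ _i : Fin d, 3 :=
        Finset.prod_le_prod (fun i _ => Nat.zero_le _) (fun i _ => Finset.card_le_three)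
    _ = 3 ^ d := by simp

/-- THE GEOMETRIC FACT behind (3.44)/(3.45): if the cube side `s` exceeds the distance `t` (p. 592: side `> r(ε)`,
distance `≤ r(ε)`), a cube within sup-distance `t` of the point `x` is the cube containing `x` or one of its `3ᵈ − 1`
neighbours. [folklore: floor arithmetic, cite: Balaban1982Higgs2, (3.44) p.592] -/
theorem near_mem_nbhd {s t : ℝ} (hs : 0 < s) (hts : t < s) {x : Fin d → ℝ} {a : Fin d → ℤ}
    (h : Near s t x a) : a ∈ nbhd s x := by
  obtain ⟨y, hy, hyx⟩ := h
  rw [nbhd, Fintype.mem_piFinset]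
  intro i
  obtain ⟨h1, h2⟩ := hy i
  have h3 := hyx i
  rw [abs_le] at h3
  set b := ⌊x i / s⌋ with hb
  have hb1 : (b : ℝ) ≤ x i / s := Int.floor_le _
  have hb2 : x i / s < b + 1 := Int.lt_floor_add_one _
  have hb1' : (b : ℝ) * s ≤ x i := by rwa [le_div_iff₀ hs] at hb1
  have hb2' : x i < ((b : ℝ) + 1) * s := by rwa [div_lt_iff₀ hs] at hb2
  have ha1 : (a i : ℝ) < (b : ℝ) + 2 := by
    by_contra hcon
    push Not at hcon
    have : ((b : ℝ) + 2) * s ≤ (a i : ℝ) * s := mul_le_mul_of_nonneg_right hcon hs.le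
    nlinarith
  have ha2 : (b : ℝ) - 2 < (a i : ℝ) := by
    by_contra hcon
    push Not at hcon
    have : ((a i : ℝ) + 1) * s ≤ ((b : ℝ) - 1) * s := by
      apply mul_le_mul_of_nonneg_right _ hs.le
      linarith
    nlinarith
  have ha1' : a i < b + 2 := by exact_mod_cast ha1
  have ha2' : b - 2 < a i := by exact_mod_cast ha2
  simp only [Finset.mem_insert, Finset.mem_singleton]
  omega

/-- (3.44)/(3.45) p. 592, KERNEL-CHECKED in the model: a finite family `𝒞` of cubes of side `s`, each within
sup-distance `t < s` of some element of the finite set `E` (= P_v⁽ᵏ⁾ ∪ … ∪ R_s⁽ᵏ⁾), has `|𝒞| ≤ 3ᵈ |E|`.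
[folklore: union bound over the 3ᵈ-neighbourhoods, cite: Balaban1982Higgs2, (3.44)–(3.45) p.592] -/
theorem card_le_three_pow_mul {s t : ℝ} (hs : 0 < s) (hts : t < s)
    (E : Finset (Fin d → ℝ)) (C : Finset (Fin d → ℤ))
    (hC : ∀ a ∈ C, ∃ x ∈ E, Near s t x a) : C.card ≤ 3 ^ d * E.card := by
  classical
  have hsub : C ⊆ E.biUnion (fun x => nbhd s x) := by
    intro a ha
    obtain ⟨x, hx, hn⟩ := hC a ha
    exact Finset.mem_biUnion.mpr ⟨x, hx, near_mem_nbhd hs hts hn⟩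
  calc C.card ≤ (E.biUnion fun x => nbhd s x).card := Finset.card_le_card hsub
    _ ≤ ∑ x ∈ E, (nbhd s x).card := Finset.card_biUnion_le
    _ ≤ ∑ _x ∈ E, 3 ^ d := Finset.sum_le_sum fun x _ => card_nbhd_le s x
    _ = 3 ^ d * E.card := by rw [Finset.sum_const, smul_eq_mul, mul_comm]

/-- (3.44) verbatim shape `|𝒞₀| ≤ 3ᵈ(|P_v⁽⁰⁾| + … + |R_s⁽⁰⁾|)` (six sets; `|P_v ∪ … ∪ R_s| ≤ |P_v| + … + |R_s|`).
[folklore: cite: Balaban1982Higgs2, (3.44) p.592] -/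
theorem card_le_three_pow_mul_six {s t : ℝ} (hs : 0 < s) (hts : t < s)
    (Pv Qv Rv Ps Qs Rs : Finset (Fin d → ℝ)) (C : Finset (Fin d → ℤ))
    (hC : ∀ a ∈ C, ∃ x ∈ Pv ∪ Qv ∪ Rv ∪ Ps ∪ Qs ∪ Rs, Near s t x a) :
    C.card ≤ 3 ^ d * (Pv.card + Qv.card + Rv.card + Ps.card + Qs.card + Rs.card) := by
  classical
  have h := card_le_three_pow_mul hs hts _ C hC
  have hu : (Pv ∪ Qv ∪ Rv ∪ Ps ∪ Qs ∪ Rs).card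
      ≤ Pv.card + Qv.card + Rv.card + Ps.card + Qs.card + Rs.card := by
    calc (Pv ∪ Qv ∪ Rv ∪ Ps ∪ Qs ∪ Rs).card ≤ (Pv ∪ Qv ∪ Rv ∪ Ps ∪ Qs).card + Rs.card :=
          Finset.card_union_le _ _
      _ ≤ (Pv ∪ Qv ∪ Rv ∪ Ps).card + Qs.card + Rs.card := by
          gcongr; exact Finset.card_union_le _ _
      _ ≤ (Pv ∪ Qv ∪ Rv).card + Ps.card + Qs.card + Rs.card := by
          gcongr; exact Finset.card_union_le _ _
      _ ≤ (Pv ∪ Qv).card + Rv.card + Ps.card + Qs.card + Rs.card := by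
          gcongr; exact Finset.card_union_le _ _
      _ ≤ Pv.card + Qv.card + Rv.card + Ps.card + Qs.card + Rs.card := by
          gcongr; exact Finset.card_union_le _ _
  exact le_trans h (Nat.mul_le_mul_left _ hu)

/-- The counting half of (3.48) p. 593 (and of (3.49), (3.50)): a finite set covered by the cubes of a family `𝒟`,
each cube containing at most `m` lattice points, has at most `m |𝒟|` points:
`Λ₀⁽⁰⁾ᶜ ⊂ ∪_{□∈𝒟₀} □ and |Λ₀⁽⁰⁾ᶜ| ≤ (2r(ε))ᵈ|𝒞₀|`. [folklore: union bound, cite: Balaban1982Higgs2, (3.48) p.593] -/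
theorem card_le_of_cover {α β : Type*} [DecidableEq α] (S : Finset α) (D : Finset β) (pts : β → Finset α)
    (m : ℕ) (hcov : S ⊆ D.biUnion pts) (hm : ∀ c ∈ D, (pts c).card ≤ m) : S.card ≤ m * D.card := by
  calc S.card ≤ (D.biUnion pts).card := Finset.card_le_card hcov
    _ ≤ ∑ c ∈ D, (pts c).card := Finset.card_biUnion_le
    _ ≤ ∑ _c ∈ D, m := Finset.sum_le_sum hm
    _ = m * D.card := by rw [Finset.sum_const, smul_eq_mul, mul_comm]

/-- The per-cube count used in (3.48): a cube of the unit lattice with INTEGER side `n` (a union of large blocks) has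
exactly `nᵈ` lattice points — hence `≤ (2r(ε))ᵈ` when `n < 2r(ε)`. [folklore: cite: Balaban1982Higgs2, (3.48) p.593] -/
theorem card_latticeCube (a : Fin d → ℤ) (n : ℕ) :
    (Fintype.piFinset fun i => Finset.Ico (a i) (a i + n)).card = n ^ d := by
  rw [Fintype.card_piFinset]
  simp

end Cubes

/-! ## 2. (3.46) p. 593: each term of (3.41) is `≤ exp(−c₀p(Lᵏε)²|𝒞_k|)`, and there are `≤ 2^{6|Λ₀⁽ᵏ⁾ᶜ|}` terms -/

/-- One term of (3.41) p. 592, verbatim: `exp(−⅛ap(Lᵏε)²|P_v⁽ᵏ⁾|) exp(−¼γ₀p(Lᵏε)²|Q_v⁽ᵏ⁾|) exp(−¼γ₀p(Lᵏε)²|R_v⁽ᵏ⁾|)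
exp(−⅛ap(Lᵏε)²|P_s⁽ᵏ⁾|) exp(−¼γ₀p(Lᵏε)²|Q_s⁽ᵏ⁾|) exp(−p(Lᵏε)²|R_s⁽ᵏ⁾|)` (`pk` = p(Lᵏε); the six cardinalities as reals).
[cite: Balaban1982Higgs2, (3.41) p.592] -/
noncomputable def term341 (a γ₀ pk : ℝ) (Pv Qv Rv Ps Qs Rs : ℝ) : ℝ :=
  Real.exp (-(a / 8) * pk ^ 2 * Pv) * Real.exp (-(γ₀ / 4) * pk ^ 2 * Qv)
  * Real.exp (-(γ₀ / 4) * pk ^ 2 * Rv) * Real.exp (-(a / 8) * pk ^ 2 * Ps)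
  * Real.exp (-(γ₀ / 4) * pk ^ 2 * Qs) * Real.exp (-pk ^ 2 * Rs)

/-- First inequality of (3.46), KERNEL-CHECKED: under (3.45) `|𝒞_k| ≤ 3ᵈ(|P_v⁽ᵏ⁾| + … + |R_s⁽ᵏ⁾|)`, with the printed
`c₀ = min{⅛a3⁻ᵈ, ¼γ₀3⁻ᵈ, 3⁻ᵈ}`, each term of (3.41) is `≤ exp(−c₀p(Lᵏε)²|𝒞_k|)`.
[folklore: `B2.step346_exponent` + monotonicity of exp, cite: Balaban1982Higgs2, (3.46) p.593] -/
theorem term341_le {a γ₀ pk : ℝ} {d : ℕ} (ha : 0 ≤ a) (hγ : 0 ≤ γ₀)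
    {Pv Qv Rv Ps Qs Rs C : ℝ} (hPv : 0 ≤ Pv) (hQv : 0 ≤ Qv) (hRv : 0 ≤ Rv) (hPs : 0 ≤ Ps) (hQs : 0 ≤ Qs)
    (hRs : 0 ≤ Rs) (h345 : C ≤ (3 : ℝ) ^ d * (Pv + Qv + Rv + Ps + Qs + Rs)) :
    term341 a γ₀ pk Pv Qv Rv Ps Qs Rs ≤ Real.exp (-(c0 a γ₀ d * pk ^ 2 * C)) := by
  have key := step346_exponent ha hγ hPv hQv hRv hPs hQs hRs h345
  unfold term341
  rw [← Real.exp_add, ← Real.exp_add, ← Real.exp_add, ← Real.exp_add, ← Real.exp_add]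
  apply Real.exp_le_exp.mpr
  have hp : 0 ≤ pk ^ 2 := sq_nonneg _
  have := mul_le_mul_of_nonneg_left key hp
  nlinarith [this]

/-- The count in (3.46), KERNEL-CHECKED: *"Σ_{all the subsets of Λ₀⁽ᵏ⁾ᶜ} … = 2^{6|Λ₀⁽ᵏ⁾ᶜ|} …"* — the number of
6-tuples `(P_v, Q_v, R_v, P_s, Q_s, R_s)` of subsets of a finite set `S` is `2^{6|S|}`.
[folklore: cite: Balaban1982Higgs2, (3.46) p.593] -/
theorem card_sixTuples {α : Type*} [DecidableEq α] (S : Finset α) :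
    (Fintype.piFinset fun _ : Fin 6 => S.powerset).card = 2 ^ (6 * S.card) := by
  rw [Fintype.card_piFinset, Finset.prod_const, Finset.card_powerset, Finset.card_univ, Fintype.card_fin,
    ← pow_mul, mul_comm]

/-- (3.46) assembled, KERNEL-CHECKED bookkeeping: a sum of at most `2^{6n}` terms each `≤ B` (`B ≥ 0`) is
`≤ 2^{6n} B` — with `B = exp(−c₀p(Lᵏε)²|𝒞_k|)` (`term341_le`) and `n = |Λ₀⁽ᵏ⁾ᶜ|` (`card_sixTuples`) this is
`ζ″_{Λ₀⁽ᵏ⁾} ≤ 2^{6|Λ₀⁽ᵏ⁾ᶜ|} exp(−c₀p(Lᵏε)²|𝒞_k|)`. [folklore: cite: Balaban1982Higgs2, (3.46) p.593] -/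
theorem ineq346 {ι : Type*} (F : Finset ι) (t : ι → ℝ) (B : ℝ) (n : ℕ) (hB : 0 ≤ B)
    (ht : ∀ f ∈ F, t f ≤ B) (hF : F.card ≤ 2 ^ (6 * n)) :
    ∑ f ∈ F, t f ≤ (2 : ℝ) ^ (6 * n) * B := by
  calc ∑ f ∈ F, t f ≤ F.card • B := Finset.sum_le_card_nsmul _ _ _ ht
    _ = (F.card : ℝ) * B := by rw [nsmul_eq_mul]
    _ ≤ (2 : ℝ) ^ (6 * n) * B := by
        apply mul_le_mul_of_nonneg_right _ hB
        exact_mod_cast hF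

/-! ## 3. (3.47)–(3.54) pp. 593–594 over the abstract carrier of (3.42) -/

/-- The combinatorial data Sect. 3.C attaches to ONE run of (3.42) (`B2.Run`): per scale `k = 0, …, K−1` and per
admissible sequence `s = (Λ₀⁽⁰⁾, …, Λ₀⁽ᴷ⁻¹⁾)`, `nC k s = |𝒞_k|` (p. 592: 𝒞₀ = the cubes of the partition of T₁ meeting
Λ₀⁽⁰⁾ᶜ; 𝒞_k = the cubes of the partition of T₁⁽ᵏ⁾, sides in ]r(Lᵏε), 2r(Lᵏε)[, meeting Λ₇⁽ᵏ⁻¹⁾′ ∩ Λ₀⁽ᵏ⁾ᶜ — p. 593: *"The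
sets 𝒞_k, more exactly their numbers of elements |𝒞_k|, will be just these basic quantities"*), `vol0c k s = |Λ₀⁽ᵏ⁾ᶜ|`,
and `volTK = |T₁⁽ᴷ⁾|`.  Pure data: how they arise is the content of the leaves below. [cite: Balaban1982Higgs2, pp.592–593] -/
structure CData (ρ : Run) where
  nC : ℕ → ρ.Seq → ℕ
  vol0c : ℕ → ρ.Seq → ℕ
  volTK : ℕ

/-- The scale-k spacing `Lᵏε`. [cite: Balaban1982Higgs2, p.582] -/
noncomputable def epsK (P : Params) (ρ : Run) (k : ℕ) : ℝ := (P.L : ℝ) ^ k * ρ.ε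

/-- `x_k = 1 + log(Lᵏε)⁻¹`, so that `p(Lᵏε) = b₀x_kᵖ`, `r(Lᵏε) = Rx_kʳ`. [cite: Balaban1982Higgs2, p.557, (2.7) p.558] -/
noncomputable def xk (P : Params) (ρ : Run) (k : ℕ) : ℝ := 1 + Real.log (epsK P ρ k)⁻¹

/-- `p(Lᵏε) = b₀x_kᵖ`. [folklore: unfolding, cite: Balaban1982Higgs2, p.557] -/
theorem pFn_epsK (P : Params) (ρ : Run) (k : ℕ) : pFn P.b₀ P.p (epsK P ρ k) = P.b₀ * xk P ρ k ^ P.p := rfl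

/-- `r(Lᵏε) = Rx_kʳ`. [folklore: unfolding, cite: Balaban1982Higgs2, (2.7) p.558] -/
theorem rFn_epsK (P : Params) (ρ : Run) (k : ℕ) : rFn P.R P.r (epsK P ρ k) = P.R * xk P ρ k ^ P.r := rfl

/-- `x_k = 1 + log ε⁻¹ − k log L`. [folklore: cite: Balaban1982Higgs2, p.594] -/
theorem xk_eq (P : Params) (ρ : Run) (hL : 0 < (P.L : ℝ)) (hε : 0 < ρ.ε) (k : ℕ) :
    xk P ρ k = 1 + Real.log ρ.ε⁻¹ - k * Real.log (P.L : ℝ) := by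
  unfold xk epsK
  have hLk : (P.L : ℝ) ^ k ≠ 0 := by positivity
  rw [Real.log_inv, Real.log_inv, Real.log_mul hLk hε.ne', Real.log_pow]
  ring

/-- Below the stopping scale every `x_k ≥ 1` (`Lᵏε ≤ Lᴷε ≤ ε₀ ≤ 1`). [folklore: cite: Balaban1982Higgs2, p.582] -/
theorem one_le_xk (P : Params) (ρ : Run) (hL : 1 ≤ (P.L : ℝ)) (hε : 0 < ρ.ε) (hK1 : epsK P ρ ρ.K ≤ 1)
    {k : ℕ} (hk : k ≤ ρ.K) : 1 ≤ xk P ρ k := by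
  unfold xk
  have hpos : 0 < epsK P ρ k := by unfold epsK; positivity
  have hle : epsK P ρ k ≤ 1 := by
    refine le_trans ?_ hK1
    unfold epsK
    exact mul_le_mul_of_nonneg_right (pow_le_pow_right₀ hL hk) hε.le
  have : 0 ≤ Real.log (epsK P ρ k)⁻¹ := Real.log_nonneg ((one_le_inv₀ hpos).mpr hle)
  linarith

/-- The stopping rule gives *"K ≤ (log L)⁻¹ log ε⁻¹"* (p. 594): `K log L ≤ log ε⁻¹` when `Lᴷε ≤ 1`.
[folklore: cite: Balaban1982Higgs2, p.594] -/
theorem K_logL_le (P : Params) (ρ : Run) (hL : 0 < (P.L : ℝ)) (hε : 0 < ρ.ε) (hK1 : epsK P ρ ρ.K ≤ 1) :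
    (ρ.K : ℝ) * Real.log (P.L : ℝ) ≤ Real.log ρ.ε⁻¹ := by
  have hpos : 0 < epsK P ρ ρ.K := by unfold epsK; positivity
  have h := Real.log_nonpos hpos.le hK1
  unfold epsK at h
  have hLk : (P.L : ℝ) ^ ρ.K ≠ 0 := by positivity
  rw [Real.log_mul hLk hε.ne', Real.log_pow] at h
  rw [Real.log_inv]
  linarith

/-- The right side of (3.47) p. 593 at the admissible sequence `s`, verbatim with the two O(1)'s named `A`, `B`:
`exp(−Σ_{k=0}^{K−1} c₀p(Lᵏε)²|𝒞_k|) · exp(Σ_{k=0}^{K−1} A(1 + log(Lᵏε)⁻¹)|Λ₀⁽ᵏ⁾ᶜ|) · exp(B|T₁⁽ᴷ⁾|)`.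
[cite: Balaban1982Higgs2, (3.47) p.593] -/
noncomputable def rhs347 (P : Params) (ρ : Run) (X : CData ρ) (A B : ℝ) (s : ρ.Seq) : ℝ :=
  Real.exp (-(∑ k ∈ range ρ.K, c0 P.a P.γ₀ P.d * pFn P.b₀ P.p (epsK P ρ k) ^ 2 * (X.nC k s : ℝ)))
  * Real.exp (∑ k ∈ range ρ.K, A * xk P ρ k * (X.vol0c k s : ℝ))
  * Real.exp (B * (X.volTK : ℝ))

/-- **LEAF (3.47)** p. 593 — the OUTPUT of the step the print introduces, directly after (3.46), only by the words
*"After easy transformations we get"*, followed by the display and two sentences: *"(the left side of (3.42))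
≤ sup_{{Λ₀⁽⁰⁾,…,Λ⁽ᴷ⁻¹⁾} admissible} [rhs347]  (3.47)  In the second exponent we have gathered all the expressions
dependent on Λ₀⁽ᵏ⁾ᶜ. The third exponent has the required form and can be omitted in further considerations."*
(v1.1 re-quotation from render p039, cell GAPS.md G-pv18-2).  Typed as stated (sup over the finite type of
admissible sequences = `⨆`); NOT proved here — the transformations (absorbing the sum over sequences into a sup, the
factors `C₇(Lᵏε)^{κ₀}|Λ₇…|`, `C₅|Λ₅…|` of (3.42) into the second exponent, and the k = K terms into the third) are not
displayed in print: cell GAPS.md G-pv04-3. [cite: Balaban1982Higgs2, (3.47) p.593] -/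
def Leaf347 (P : Params) (ρ : Run) (X : CData ρ) (A B : ℝ) : Prop :=
  lhs342 P ρ ≤ ⨆ s : ρ.Seq, rhs347 P ρ X A B s

/-- The printed coefficient of `|𝒞_l|` in (3.50) p. 593 (before the d-th power), `l ≤ k`: for `l = k` it is
`2r(Lᵏε)`; for `l < k` it is `L^{−(k−l)}22r(Lˡε) + L^{−(k−l−1)}20r(L^{l+1}ε) + … + L⁻¹20r(L^{k−1}ε)`, written with the
summation index `j = k − m ∈ [1, k−l−1]` as `L^{−(k−l)}22r(Lˡε) + Σ_j L^{−j}20r(L^{k−j}ε)` ((3.49): corridors of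
thickness `< 10r`, cube side `< 22r(ε)`, rescaled `< L⁻¹22r(ε)`). [cite: Balaban1982Higgs2, (3.48)–(3.50) p.593] -/
noncomputable def coef350 (P : Params) (ρ : Run) (k l : ℕ) : ℝ :=
  if l = k then 2 * rFn P.R P.r (epsK P ρ k)
  else ((P.L : ℝ)⁻¹) ^ (k - l) * (22 * rFn P.R P.r (epsK P ρ l))
    + ∑ j ∈ Ico 1 (k - l), ((P.L : ℝ)⁻¹) ^ j * (20 * rFn P.R P.r (epsK P ρ (k - j)))

/-- **LEAF (3.50)** p. 593 — the OUTPUT of the printed corridor construction (3.48)–(3.50) (*"To each cube from 𝒟₀ we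
add a 'corridor' consisting of large blocks and of thickness > 9r(ε), but < 10r(ε). We get a cube with a side of length
< 22r(ε) and we apply the operation ′ to it … After rescaling we get a cube of the lattice T₁⁽¹⁾ with a side of length
< L⁻¹22r(ε). We add 𝒞₁ to the obtained set of cubes and we denote the sum by 𝒟₁ … We continue this procedure"*):
`|Λ₀⁽ᵏ⁾ᶜ| ≤ Σ_{l=0}^{k} (coef350 k l)ᵈ |𝒞_l|` for every k ≤ K − 1 and every admissible sequence.  A geometric statement
about the block/rescaling structure of the lattices T₁⁽ᵏ⁾, typed as its printed cardinality consequence and NOT proved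
here (its counting half is `card_le_of_cover` / `card_latticeCube`). [cite: Balaban1982Higgs2, (3.50) p.593] -/
def Bound350 (P : Params) (ρ : Run) (X : CData ρ) : Prop :=
  ∀ s : ρ.Seq, ∀ k, k < ρ.K →
    (X.vol0c k s : ℝ) ≤ ∑ l ∈ range (k + 1), coef350 P ρ k l ^ P.d * (X.nC l s : ℝ)

/-- The shape (3.52) p. 594 with its O(1) named `D`: `|Λ₀⁽ᵏ⁾ᶜ| ≤ D r(Lᵏε)ᵈ (|𝒞₀| + … + |𝒞_k|)`, k ≤ K − 1.
[cite: Balaban1982Higgs2, (3.52) p.594] -/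
def Bound352 (P : Params) (ρ : Run) (X : CData ρ) (D : ℝ) : Prop :=
  ∀ s : ρ.Seq, ∀ k, k < ρ.K →
    (X.vol0c k s : ℝ) ≤ D * rFn P.R P.r (epsK P ρ k) ^ P.d * ∑ j ∈ range (k + 1), (X.nC j s : ℝ)

/-! ### (3.51) p. 594, kernel-checked: `r(Lᵏ⁻ʲε) ≤ (1 + j log L)ʳ r(Lᵏε)` and the series `Σ_j L⁻ʲ(1 + j log L)ʳ` -/

/-- The j-th term of the series in (3.51): `L⁻ʲ(1 + j log L)ʳ`. [cite: Balaban1982Higgs2, (3.51) p.594] -/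
noncomputable def term351 (L r : ℝ) (j : ℕ) : ℝ := (L⁻¹) ^ j * (1 + j * Real.log L) ^ r

/-- The printed constant `Σ_{j=0}^∞ L⁻ʲ(1 + j log L)ʳ` of (3.51). [cite: Balaban1982Higgs2, (3.51) p.594] -/
noncomputable def S351 (L r : ℝ) : ℝ := ∑' j : ℕ, term351 L r j

/-- The terms of (3.51) are ≥ 0. [folklore: cite: Balaban1982Higgs2, (3.51) p.594] -/
theorem term351_nonneg {L r : ℝ} (hL : 1 < L) (j : ℕ) : 0 ≤ term351 L r j := by
  unfold term351
  have h1 : 0 ≤ Real.log L := Real.log_nonneg hL.le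
  have : 0 ≤ 1 + (j : ℝ) * Real.log L := by positivity
  exact mul_nonneg (pow_nonneg (inv_nonneg.mpr (by linarith)) _) (Real.rpow_nonneg this _)

/-- `Σ_j L⁻ʲ(1 + j log L)ʳ < ∞` for L > 1 (comparison with `(j+1)^⌈r⌉ L⁻ʲ`).
[folklore: polynomial times geometric is summable, cite: Balaban1982Higgs2, (3.51) p.594] -/
theorem summable_term351 {L r : ℝ} (hL : 1 < L) : Summable (term351 L r) := by
  set c := Real.log L with hc
  set N := ⌈r⌉₊ with hN
  have hc0 : 0 ≤ c := Real.log_nonneg hL.le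
  have hL0 : 0 < L := by linarith
  have hq : ‖(L⁻¹ : ℝ)‖ < 1 := by
    rw [Real.norm_eq_abs, abs_of_pos (inv_pos.mpr hL0)]
    exact inv_lt_one_of_one_lt₀ hL
  have hg : Summable (fun n : ℕ => ((n : ℝ)) ^ N * (L⁻¹) ^ n) :=
    summable_pow_mul_geometric_of_norm_lt_one N hq
  have hg1 : Summable (fun n : ℕ => (((n + 1 : ℕ) : ℝ)) ^ N * (L⁻¹) ^ (n + 1)) :=
    (summable_nat_add_iff 1).mpr hg
  have hdom : Summable (fun n : ℕ => ((1 + c) ^ N * L) * ((((n + 1 : ℕ) : ℝ)) ^ N * (L⁻¹) ^ (n + 1))) :=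
    hg1.mul_left _
  refine Summable.of_nonneg_of_le (fun j => term351_nonneg hL j) (fun j => ?_) hdom
  unfold term351
  have hb1 : 1 ≤ 1 + (j : ℝ) * c := by nlinarith
  have hrN : r ≤ (N : ℝ) := by rw [hN]; exact Nat.le_ceil r
  have h1 : (1 + (j : ℝ) * c) ^ r ≤ (1 + (j : ℝ) * c) ^ (N : ℝ) :=
    Real.rpow_le_rpow_of_exponent_le hb1 hrN
  rw [Real.rpow_natCast] at h1
  have h2 : (1 + (j : ℝ) * c) ^ N ≤ ((1 + c) * ((j + 1 : ℕ) : ℝ)) ^ N := by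
    apply pow_le_pow_left₀ (by linarith)
    push_cast
    nlinarith
  rw [mul_pow] at h2
  have h3 : (L⁻¹ : ℝ) ^ j = L * (L⁻¹) ^ (j + 1) := by
    rw [pow_succ]
    field_simp
  rw [h3]
  have h4 : 0 ≤ L * (L⁻¹ : ℝ) ^ (j + 1) := by positivity
  calc L * (L⁻¹) ^ (j + 1) * (1 + (j : ℝ) * c) ^ r ≤ L * (L⁻¹) ^ (j + 1) * ((1 + c) ^ N * ((j + 1 : ℕ) : ℝ) ^ N) :=
        mul_le_mul_of_nonneg_left (le_trans h1 h2) h4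
    _ = (1 + c) ^ N * L * ((((j + 1 : ℕ) : ℝ)) ^ N * (L⁻¹) ^ (j + 1)) := by ring

/-- Partial sums are below the series. [folklore: cite: Balaban1982Higgs2, (3.51) p.594] -/
theorem sum_le_S351 {L r : ℝ} (hL : 1 < L) (s : Finset ℕ) :
    ∑ j ∈ s, term351 L r j ≤ S351 L r :=
  (summable_term351 hL).sum_le_tsum s (fun j _ => term351_nonneg hL j)

/-- `S351 ≥ 1` (its j = 0 term). [folklore: cite: Balaban1982Higgs2, (3.51) p.594] -/
theorem one_le_S351 {L r : ℝ} (hL : 1 < L) : 1 ≤ S351 L r := by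
  have h := sum_le_S351 (r := r) hL {0}
  simpa [term351] using h

/-- `x_{k−j} = x_k + j log L` (j ≤ k). [folklore: cite: Balaban1982Higgs2, p.594] -/
theorem xk_sub_eq (P : Params) (ρ : Run) (hL : 0 < (P.L : ℝ)) (hε : 0 < ρ.ε) {j k : ℕ} (hjk : j ≤ k) :
    xk P ρ (k - j) = xk P ρ k + j * Real.log (P.L : ℝ) := by
  rw [xk_eq P ρ hL hε, xk_eq P ρ hL hε, Nat.cast_sub hjk]
  ring

/-- (3.51), first claim p. 594, KERNEL-CHECKED: `r(Lᵏ⁻ʲε) ≤ (1 + j log L)ʳ r(Lᵏε)` for j ≤ k ≤ K (where `x_k ≥ 1`),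
since `x_{k−j} = x_k + j log L ≤ (1 + j log L)x_k`. [folklore: cite: Balaban1982Higgs2, (3.51) p.594] -/
theorem r_rescale_le (P : Params) (ρ : Run) (hL : 1 ≤ (P.L : ℝ)) (hR : 0 ≤ P.R) (hr : 0 ≤ P.r) (hε : 0 < ρ.ε)
    (hK1 : epsK P ρ ρ.K ≤ 1) {j k : ℕ} (hjk : j ≤ k) (hk : k ≤ ρ.K) :
    rFn P.R P.r (epsK P ρ (k - j)) ≤ (1 + j * Real.log (P.L : ℝ)) ^ P.r * rFn P.R P.r (epsK P ρ k) := by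
  have hL0 : 0 < (P.L : ℝ) := by linarith
  have hx1 : 1 ≤ xk P ρ k := one_le_xk P ρ hL hε hK1 hk
  have hlog : 0 ≤ Real.log (P.L : ℝ) := Real.log_nonneg hL
  have hjl : 0 ≤ (j : ℝ) * Real.log (P.L : ℝ) := by positivity
  rw [rFn_epsK, rFn_epsK, xk_sub_eq P ρ hL0 hε hjk]
  have hle : xk P ρ k + j * Real.log (P.L : ℝ) ≤ (1 + j * Real.log (P.L : ℝ)) * xk P ρ k := by nlinarith
  have h0 : 0 ≤ xk P ρ k + j * Real.log (P.L : ℝ) := by linarith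
  have h1 : (xk P ρ k + j * Real.log (P.L : ℝ)) ^ P.r ≤ ((1 + j * Real.log (P.L : ℝ)) * xk P ρ k) ^ P.r :=
    Real.rpow_le_rpow h0 hle hr
  rw [Real.mul_rpow (by linarith) (by linarith)] at h1
  calc P.R * (xk P ρ k + j * Real.log (P.L : ℝ)) ^ P.r
      ≤ P.R * ((1 + j * Real.log (P.L : ℝ)) ^ P.r * xk P ρ k ^ P.r) := mul_le_mul_of_nonneg_left h1 hR
    _ = (1 + j * Real.log (P.L : ℝ)) ^ P.r * (P.R * xk P ρ k ^ P.r) := by ring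

/-- (3.51), second claim p. 594, KERNEL-CHECKED with the d-th power restored (the print drops it on the middle
expression; cell DIVERGENCE.md D-pv04.3): *"the factor standing at |𝒞_l| can be estimated by (22r(Lᵏε))ᵈ(L^{−(k−1)}(1 +
(k−1)log L)ʳ + … + L⁻¹(1 + log L)ʳ + 1) ≤ 22ᵈ Σ_{j=0}^∞ L⁻ʲ(1 + j log L)ʳ (r(Lᵏε))ᵈ = O(1)(r(Lᵏε))ᵈ"* — here:
`coef350 k l ≤ 22 · S351 · r(Lᵏε)` for l ≤ k ≤ K − 1. [folklore: cite: Balaban1982Higgs2, (3.51) p.594] -/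
theorem coef350_le (P : Params) (ρ : Run) (hL : 1 < (P.L : ℝ)) (hR : 0 ≤ P.R) (hr : 0 ≤ P.r) (hε : 0 < ρ.ε)
    (hK1 : epsK P ρ ρ.K ≤ 1) {k l : ℕ} (hlk : l ≤ k) (hk : k < ρ.K) :
    coef350 P ρ k l ≤ 22 * S351 (P.L : ℝ) P.r * rFn P.R P.r (epsK P ρ k) := by
  have hL1 : 1 ≤ (P.L : ℝ) := hL.le
  have hL0 : 0 < (P.L : ℝ) := by linarith
  have hS1 : 1 ≤ S351 (P.L : ℝ) P.r := one_le_S351 hL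
  have hx1 : 1 ≤ xk P ρ k := one_le_xk P ρ hL1 hε hK1 hk.le
  have hrk : 0 ≤ rFn P.R P.r (epsK P ρ k) := by
    rw [rFn_epsK]; exact mul_nonneg hR (Real.rpow_nonneg (by linarith) _)
  unfold coef350
  split_ifs with h
  · -- l = k : 2 r_k ≤ 22 S r_k
    nlinarith
  · have hlk' : l < k := lt_of_le_of_ne hlk h
    -- each term `L⁻ʲ · c · r(L^{k-j}ε)` with c ≤ 22 is ≤ 22 r_k · term351 j
    have hterm : ∀ j, j ≤ k → ∀ c : ℝ, 0 ≤ c → c ≤ 22 →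
        ((P.L : ℝ)⁻¹) ^ j * (c * rFn P.R P.r (epsK P ρ (k - j)))
          ≤ 22 * rFn P.R P.r (epsK P ρ k) * term351 (P.L : ℝ) P.r j := by
      intro j hj c hc0 hc
      have h1 := r_rescale_le P ρ hL1 hR hr hε hK1 hj hk.le
      have hLj : 0 ≤ ((P.L : ℝ)⁻¹) ^ j := pow_nonneg (inv_nonneg.mpr hL0.le) _
      have hpw : 0 ≤ (1 + (j : ℝ) * Real.log (P.L : ℝ)) ^ P.r :=
        Real.rpow_nonneg (by nlinarith [Real.log_nonneg hL1]) _
      unfold term351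
      have hrm : 0 ≤ rFn P.R P.r (epsK P ρ (k - j)) := by
        rw [rFn_epsK]
        exact mul_nonneg hR (Real.rpow_nonneg (by
          have := one_le_xk P ρ hL1 hε hK1 (le_trans (Nat.sub_le k j) hk.le); linarith) _)
      calc ((P.L : ℝ)⁻¹) ^ j * (c * rFn P.R P.r (epsK P ρ (k - j)))
          ≤ ((P.L : ℝ)⁻¹) ^ j * (22 * ((1 + j * Real.log (P.L : ℝ)) ^ P.r * rFn P.R P.r (epsK P ρ k))) := by
            apply mul_le_mul_of_nonneg_left _ hLj
            exact mul_le_mul hc h1 hrm (by norm_num)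
        _ = 22 * rFn P.R P.r (epsK P ρ k) * (((P.L : ℝ)⁻¹) ^ j * (1 + j * Real.log (P.L : ℝ)) ^ P.r) := by ring
    -- the first term (j = k - l, c = 22) and the sum (j ∈ [1, k-l-1], c = 20)
    have hfirst := hterm (k - l) (Nat.sub_le k l) 22 (by norm_num) le_rfl
    have hsum : ∑ j ∈ Ico 1 (k - l), ((P.L : ℝ)⁻¹) ^ j * (20 * rFn P.R P.r (epsK P ρ (k - j)))
        ≤ ∑ j ∈ Ico 1 (k - l), 22 * rFn P.R P.r (epsK P ρ k) * term351 (P.L : ℝ) P.r j := by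
      apply Finset.sum_le_sum
      intro j hj
      have hj' : j ≤ k := le_trans (le_trans (mem_Ico.mp hj).2.le (Nat.sub_le k l)) le_rfl
      exact hterm j hj' 20 (by norm_num) (by norm_num)
    have hsplit : 22 * rFn P.R P.r (epsK P ρ k) * term351 (P.L : ℝ) P.r (k - l)
        + ∑ j ∈ Ico 1 (k - l), 22 * rFn P.R P.r (epsK P ρ k) * term351 (P.L : ℝ) P.r j
        = 22 * rFn P.R P.r (epsK P ρ k) * ∑ j ∈ Ico 1 (k - l + 1), term351 (P.L : ℝ) P.r j := by
      rw [Finset.sum_Ico_succ_top (by omega : 1 ≤ k - l), mul_add, Finset.mul_sum]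
      ring
    have hpart : ∑ j ∈ Ico 1 (k - l + 1), term351 (P.L : ℝ) P.r j ≤ S351 (P.L : ℝ) P.r :=
      sum_le_S351 hL _
    calc ((P.L : ℝ)⁻¹) ^ (k - l) * (22 * rFn P.R P.r (epsK P ρ l))
          + ∑ j ∈ Ico 1 (k - l), ((P.L : ℝ)⁻¹) ^ j * (20 * rFn P.R P.r (epsK P ρ (k - j)))
        ≤ 22 * rFn P.R P.r (epsK P ρ k) * term351 (P.L : ℝ) P.r (k - l)
          + ∑ j ∈ Ico 1 (k - l), 22 * rFn P.R P.r (epsK P ρ k) * term351 (P.L : ℝ) P.r j := by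
            have e : k - (k - l) = l := by omega
            rw [e] at hfirst
            exact add_le_add hfirst hsum
      _ = 22 * rFn P.R P.r (epsK P ρ k) * ∑ j ∈ Ico 1 (k - l + 1), term351 (P.L : ℝ) P.r j := hsplit
      _ ≤ 22 * rFn P.R P.r (epsK P ρ k) * S351 (P.L : ℝ) P.r :=
            mul_le_mul_of_nonneg_left hpart (by positivity)
      _ = 22 * S351 (P.L : ℝ) P.r * rFn P.R P.r (epsK P ρ k) := by ring

/-- (3.52) from (3.50) and (3.51), KERNEL-CHECKED: `Bound350 ⇒ Bound352` with `D = (22·S351)ᵈ`, i.e.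
`|Λ₀⁽ᵏ⁾ᶜ| ≤ O(1) r(Lᵏε)ᵈ(|𝒞₀| + … + |𝒞_k|)` *"hence"* (3.52). [folklore: cite: Balaban1982Higgs2, (3.50)–(3.52) pp.593–594] -/
theorem bound352_of_350 (P : Params) (ρ : Run) (X : CData ρ) (hL : 1 < (P.L : ℝ)) (hR : 0 ≤ P.R) (hr : 0 ≤ P.r)
    (hε : 0 < ρ.ε) (hK1 : epsK P ρ ρ.K ≤ 1) (h350 : Bound350 P ρ X) :
    Bound352 P ρ X ((22 * S351 (P.L : ℝ) P.r) ^ P.d) := by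
  intro s k hk
  refine le_trans (h350 s k hk) ?_
  rw [Finset.mul_sum]
  apply Finset.sum_le_sum
  intro l hl
  have hlk : l ≤ k := Nat.lt_succ_iff.mp (mem_range.mp hl)
  have hc := coef350_le P ρ hL hR hr hε hK1 hlk hk
  have hc0 : 0 ≤ coef350 P ρ k l := by
    have hL0 : 0 < (P.L : ℝ) := by linarith
    have hrl : ∀ m, m ≤ ρ.K → 0 ≤ rFn P.R P.r (epsK P ρ m) := fun m hm => by
      rw [rFn_epsK]
      exact mul_nonneg hR (Real.rpow_nonneg (by have := one_le_xk P ρ hL.le hε hK1 hm; linarith) _)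
    unfold coef350
    split_ifs
    · exact mul_nonneg (by norm_num) (hrl k hk.le)
    · apply add_nonneg
      · exact mul_nonneg (pow_nonneg (inv_nonneg.mpr hL0.le) _) (mul_nonneg (by norm_num) (hrl l (le_trans hlk hk.le)))
      · apply Finset.sum_nonneg
        intro j hj
        exact mul_nonneg (pow_nonneg (inv_nonneg.mpr hL0.le) _)
          (mul_nonneg (by norm_num) (hrl (k - j) (le_trans (Nat.sub_le k j) hk.le)))
  have hn : 0 ≤ (X.nC l s : ℝ) := Nat.cast_nonneg _
  calc coef350 P ρ k l ^ P.d * (X.nC l s : ℝ)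
      ≤ (22 * S351 (P.L : ℝ) P.r * rFn P.R P.r (epsK P ρ k)) ^ P.d * (X.nC l s : ℝ) :=
        mul_le_mul_of_nonneg_right (pow_le_pow_left₀ hc0 hc _) hn
    _ = (22 * S351 (P.L : ℝ) P.r) ^ P.d * rFn P.R P.r (epsK P ρ k) ^ P.d * (X.nC l s : ℝ) := by
        rw [mul_pow]

/-! ### (3.53)–(3.54) p. 594: the exponent of (3.47) is `≤ O(1)|T₁⁽ᴷ⁾|` -/

/-- `(xʳ)ⁿ = x^{rn}` for x ≥ 0 (real r, natural n). [folklore: `Real.rpow_mul`, `Real.rpow_natCast`] -/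
theorem rpow_natPow {x r : ℝ} (hx : 0 ≤ x) (n : ℕ) : (x ^ r) ^ n = x ^ (r * n) := by
  rw [Real.rpow_mul hx, Real.rpow_natCast]

/-- (3.53) + (3.54), KERNEL-CHECKED: for every admissible sequence, the first two exponents of (3.47) together are
`≤ 0`, GIVEN (3.52) with constant `D`, the O(1) `A` of the second exponent, `r ≥ 2`, the stopping rule (`Lᴷε ≤ 1`, so
*"K ≤ (log L)⁻¹ log ε⁻¹, K − k ≤ (log L)⁻¹ log(Lᵏε)⁻¹"*), and the per-scale constant condition of (3.54) with
`O(1) = A·D/(R log L)`: `(A D/(R log L)) R^{d+1} ≤ c₀ b₀² x_k^{2p−(d+1)r}` (k < K) — which is what *"if 2p ≥ (d+1)r and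
ε₀ is sufficiently small"* supplies (`B2.coeff354_threshold`, `B2.logScale_ge`; equality case: cell GAPS.md G-pv04-2).
Chain: `Σ_k A x_k|Λ₀⁽ᵏ⁾ᶜ| ≤ A D Σ_k r_kᵈ x_k Σ_{j≤k}|𝒞_j|` (3.52) `= A D Σ_j |𝒞_j| Σ_{k≥j} r_kᵈ x_k` (`B2.sum353_exchange`)
`≤ Σ_j (A D/(R log L)) r_j^{d+1}|𝒞_j|` (`B2.inner353_bound`) and `c₀p_k² ≥ (A D/(R log L)) r_k^{d+1}` (`B2.coeff354_nonneg`).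
[folklore: cite: Balaban1982Higgs2, (3.53)–(3.54) p.594] -/
theorem exponent_nonpos (P : Params) (ρ : Run) (X : CData ρ) {A D : ℝ}
    (hL : 1 < (P.L : ℝ)) (hR : 0 < P.R) (hr : 2 ≤ P.r) (hε : 0 < ρ.ε) (hK1 : epsK P ρ ρ.K ≤ 1)
    (hA : 0 ≤ A) (hD : 0 ≤ D) (h352 : Bound352 P ρ X D)
    (hcond : ∀ k, k < ρ.K → A * D / (P.R * Real.log (P.L : ℝ)) * P.R ^ (P.d + 1)
        ≤ c0 P.a P.γ₀ P.d * P.b₀ ^ 2 * xk P ρ k ^ (2 * P.p - ((P.d : ℝ) + 1) * P.r))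
    (s : ρ.Seq) :
    -(∑ k ∈ range ρ.K, c0 P.a P.γ₀ P.d * pFn P.b₀ P.p (epsK P ρ k) ^ 2 * (X.nC k s : ℝ))
      + ∑ k ∈ range ρ.K, A * xk P ρ k * (X.vol0c k s : ℝ) ≤ 0 := by
  set K := ρ.K with hKdef
  set logL := Real.log (P.L : ℝ) with hlogL
  set ℓ := Real.log ρ.ε⁻¹ with hℓ
  have hL0 : 0 < (P.L : ℝ) := by linarith
  have hlogL0 : 0 < logL := Real.log_pos hL
  have hxk : ∀ k, xk P ρ k = 1 + ℓ - k * logL := fun k => xk_eq P ρ hL0 hε k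
  have hKℓ : (K : ℝ) * logL ≤ ℓ := K_logL_le P ρ hL0 hε hK1
  have hx1 : ∀ k, k ≤ K → 1 ≤ xk P ρ k := fun k hk => one_le_xk P ρ hL.le hε hK1 hk
  set C' : ℝ := A * D / (P.R * logL) with hC'
  have hC'0 : 0 ≤ C' := by rw [hC']; positivity
  -- r_k as R x_k^r, and the needed power identities
  have hrk : ∀ k, rFn P.R P.r (epsK P ρ k) = P.R * xk P ρ k ^ P.r := fun k => rFn_epsK P ρ k
  -- Step 2: insert (3.52)
  have step2 : ∑ k ∈ range K, A * xk P ρ k * (X.vol0c k s : ℝ)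
      ≤ ∑ k ∈ range K, A * xk P ρ k * (D * rFn P.R P.r (epsK P ρ k) ^ P.d
          * ∑ j ∈ range (k + 1), (X.nC j s : ℝ)) := by
    apply Finset.sum_le_sum
    intro k hk
    have hk' := mem_range.mp hk
    have hx : 0 ≤ xk P ρ k := le_trans zero_le_one (hx1 k hk'.le)
    exact mul_le_mul_of_nonneg_left (h352 s k hk') (mul_nonneg hA hx)
  -- Step 3: exchange the summations
  have step3 : ∑ k ∈ range K, A * xk P ρ k * (D * rFn P.R P.r (epsK P ρ k) ^ P.d
          * ∑ j ∈ range (k + 1), (X.nC j s : ℝ))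
      = A * D * ∑ j ∈ range K, (X.nC j s : ℝ) * ∑ k ∈ Ico j K, rFn P.R P.r (epsK P ρ k) ^ P.d * xk P ρ k := by
    rw [← sum353_exchange K (fun k => rFn P.R P.r (epsK P ρ k) ^ P.d * xk P ρ k) (fun j => (X.nC j s : ℝ)),
      Finset.mul_sum]
    refine Finset.sum_congr rfl fun k _ => by ring
  -- Step 4: the inner bound
  have step4 : ∀ j ∈ range K, (X.nC j s : ℝ) * ∑ k ∈ Ico j K, rFn P.R P.r (epsK P ρ k) ^ P.d * xk P ρ k
      ≤ (X.nC j s : ℝ) * (rFn P.R P.r (epsK P ρ j) ^ (P.d + 1) / (P.R * logL)) := by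
    intro j hj
    have hj' := mem_range.mp hj
    apply mul_le_mul_of_nonneg_left _ (Nat.cast_nonneg _)
    have hin := inner353_bound (d := P.d) hR.le hr hlogL0 hKℓ hj'
    have hconv : ∑ k ∈ Ico j K, rFn P.R P.r (epsK P ρ k) ^ P.d * xk P ρ k
        = ∑ k ∈ Ico j K, P.R ^ P.d * (1 + ℓ - k * logL) ^ (P.r * P.d) * (1 + ℓ - k * logL) := by
      refine Finset.sum_congr rfl fun k hk => ?_
      have hkK : k ≤ K := (mem_Ico.mp hk).2.le
      have hx0 : 0 ≤ xk P ρ k := le_trans zero_le_one (hx1 k hkK)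
      rw [hrk k, mul_pow, rpow_natPow hx0, ← hxk k]
    rw [hconv]
    refine le_trans hin (le_of_eq ?_)
    have hx0 : 0 ≤ xk P ρ j := le_trans zero_le_one (hx1 j hj'.le)
    rw [← hxk j, hrk j, mul_pow, rpow_natPow hx0 (P.d + 1)]
    push_cast
    field_simp
    ring
  -- Steps 2–4 combined: the second exponent ≤ Σ_j C' r_j^{d+1} |𝒞_j|
  have hE2 : ∑ k ∈ range K, A * xk P ρ k * (X.vol0c k s : ℝ)
      ≤ ∑ j ∈ range K, C' * rFn P.R P.r (epsK P ρ j) ^ (P.d + 1) * (X.nC j s : ℝ) := by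
    refine le_trans step2 ?_
    rw [step3]
    have hAD : 0 ≤ A * D := mul_nonneg hA hD
    calc A * D * ∑ j ∈ range K, (X.nC j s : ℝ) * ∑ k ∈ Ico j K, rFn P.R P.r (epsK P ρ k) ^ P.d * xk P ρ k
        ≤ A * D * ∑ j ∈ range K, (X.nC j s : ℝ) * (rFn P.R P.r (epsK P ρ j) ^ (P.d + 1) / (P.R * logL)) :=
          mul_le_mul_of_nonneg_left (Finset.sum_le_sum step4) hAD
      _ = ∑ j ∈ range K, C' * rFn P.R P.r (epsK P ρ j) ^ (P.d + 1) * (X.nC j s : ℝ) := by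
          rw [hC', Finset.mul_sum]
          refine Finset.sum_congr rfl fun j _ => ?_
          field_simp
  -- (3.54): every coefficient c₀ p_k² − C' r_k^{d+1} is ≥ 0
  have hcoef : ∀ k, k < K → 0 ≤ c0 P.a P.γ₀ P.d * pFn P.b₀ P.p (epsK P ρ k) ^ 2
      - C' * rFn P.R P.r (epsK P ρ k) ^ (P.d + 1) := by
    intro k hk
    have h := coeff354_nonneg (hx1 k hk.le) (hcond k hk)
    rw [pFn_epsK, hrk k]
    linarith
  have h354 := sum354_nonpos K
    (fun k => c0 P.a P.γ₀ P.d * pFn P.b₀ P.p (epsK P ρ k) ^ 2 - C' * rFn P.R P.r (epsK P ρ k) ^ (P.d + 1))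
    (fun k => (X.nC k s : ℝ)) hcoef (fun k _ => Nat.cast_nonneg _)
  have hrw : ∑ k ∈ range K, (c0 P.a P.γ₀ P.d * pFn P.b₀ P.p (epsK P ρ k) ^ 2
        - C' * rFn P.R P.r (epsK P ρ k) ^ (P.d + 1)) * (X.nC k s : ℝ)
      = ∑ k ∈ range K, c0 P.a P.γ₀ P.d * pFn P.b₀ P.p (epsK P ρ k) ^ 2 * (X.nC k s : ℝ)
        - ∑ k ∈ range K, C' * rFn P.R P.r (epsK P ρ k) ^ (P.d + 1) * (X.nC k s : ℝ) := by
    rw [← Finset.sum_sub_distrib]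
    refine Finset.sum_congr rfl fun k _ => by ring
  rw [hrw] at h354
  linarith

/-- **(3.42) ⇐ (3.47) ∧ (3.52)**, KERNEL-CHECKED — p. 594: *"Thus from (3.47) inequality (3.42) follows"*.  For ONE run:
the leaf (3.47) with O(1)'s `A, B ≥ 0`, the bound (3.52) with O(1) `D ≥ 0` (e.g. from the leaf (3.50) by
`bound352_of_350`), `|T₁⁽ᴷ⁾| ≤ |T_ε|`, the printed parameter signs with `r ≥ 2`, the stopping rule in the form `Lᴷε ≤ 1`,
and the per-scale constant condition of (3.54) give `(3.42)` with right side `exp(B|T_ε|)`.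
[folklore: bookkeeping of the printed proof, cite: Balaban1982Higgs2, (3.47)–(3.54) pp.593–594] -/
theorem ineq342_of_leaves (P : Params) (ρ : Run) (X : CData ρ) {A B D : ℝ}
    (hL : 1 < (P.L : ℝ)) (hR : 0 < P.R) (hr : 2 ≤ P.r) (hε : 0 < ρ.ε) (hK1 : epsK P ρ ρ.K ≤ 1)
    (hA : 0 ≤ A) (hB : 0 ≤ B) (hD : 0 ≤ D) (hT : X.volTK ≤ ρ.volT)
    (h347 : Leaf347 P ρ X A B) (h352 : Bound352 P ρ X D)
    (hcond : ∀ k, k < ρ.K → A * D / (P.R * Real.log (P.L : ℝ)) * P.R ^ (P.d + 1)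
        ≤ c0 P.a P.γ₀ P.d * P.b₀ ^ 2 * xk P ρ k ^ (2 * P.p - ((P.d : ℝ) + 1) * P.r)) :
    Ineq342With P ρ B := by
  unfold Ineq342With
  refine le_trans h347 (Real.iSup_le (fun s => ?_) (by positivity))
  have hexp := exponent_nonpos P ρ X hL hR hr hε hK1 hA hD h352 hcond s
  unfold rhs347
  have h1 : Real.exp (-(∑ k ∈ range ρ.K, c0 P.a P.γ₀ P.d * pFn P.b₀ P.p (epsK P ρ k) ^ 2 * (X.nC k s : ℝ)))
      * Real.exp (∑ k ∈ range ρ.K, A * xk P ρ k * (X.vol0c k s : ℝ)) ≤ 1 := by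
    rw [← Real.exp_add]
    exact Real.exp_le_one_iff.mpr hexp
  have h2 : Real.exp (B * (X.volTK : ℝ)) ≤ Real.exp (B * (ρ.volT : ℝ)) := by
    apply Real.exp_le_exp.mpr
    exact mul_le_mul_of_nonneg_left (by exact_mod_cast hT) hB
  calc _ ≤ 1 * Real.exp (B * (ρ.volT : ℝ)) := mul_le_mul h1 h2 (by positivity) zero_le_one
    _ = Real.exp (B * (ρ.volT : ℝ)) := one_mul _

/-- `c₀ > 0` for a, γ₀ > 0. [folklore: cite: Balaban1982Higgs2, p.593] -/
theorem c0_pos {a γ₀ : ℝ} (ha : 0 < a) (hγ : 0 < γ₀) (d : ℕ) : 0 < c0 a γ₀ d := by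
  unfold c0
  refine lt_min (lt_min ?_ ?_) ?_ <;> positivity

/-- **The claim of Sect. 3.C from its leaves, uniformly over a family of runs** (the quantifier structure of
`B2.Claim342Printed`), KERNEL-CHECKED in the STRICT case `2p > (d+1)r`: if every run of the family (0 < ε ≤ ε₀, stopping
rule at ε₀) satisfies the leaf (3.47) with the same O(1)'s `A, B` and the bound (3.52) with the same O(1) `D`, then
`B2.Claim342Printed` holds — *"ε₀ is sufficiently small"* = `ε₀ ≤ min{1, exp(1 − x₀)}` with `x₀` the threshold of
`B2.coeff354_threshold`, and the right-side constant of (3.42) is `B`, independent of ε.  (Equality case 2p = (d+1)r: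
`claim342_of_leaves_of_const`.) [folklore: bookkeeping of the printed proof, cite: Balaban1982Higgs2, Sect. 3.C pp.592–594] -/
theorem claim342_of_leaves {I : Type} (P : Params) (fam : ℝ → I → Run) (X : ∀ ε₀ i, CData (fam ε₀ i))
    {A B D : ℝ} (hP : P.Printed) (hr : 2 ≤ P.r) (hA : 0 ≤ A) (hB : 0 ≤ B) (hD : 0 ≤ D)
    (hpr : ((P.d : ℝ) + 1) * P.r < 2 * P.p)
    (hT : ∀ ε₀ i, (X ε₀ i).volTK ≤ (fam ε₀ i).volT)
    (h347 : ∀ ε₀ i, 0 < (fam ε₀ i).ε → (fam ε₀ i).ε ≤ ε₀ → (fam ε₀ i).StopsAt P ε₀ →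
      Leaf347 P (fam ε₀ i) (X ε₀ i) A B)
    (h352 : ∀ ε₀ i, 0 < (fam ε₀ i).ε → (fam ε₀ i).ε ≤ ε₀ → (fam ε₀ i).StopsAt P ε₀ → ε₀ ≤ 1 →
      Bound352 P (fam ε₀ i) (X ε₀ i) D) :
    Claim342Printed P fam := by
  intro _
  obtain ⟨_, _, hL, _, ha, hγ, hb, hR⟩ := hP
  have hL' : 1 < (P.L : ℝ) := by exact_mod_cast hL
  have hlogL : 0 < Real.log (P.L : ℝ) := Real.log_pos hL'
  have hc : 0 < c0 P.a P.γ₀ P.d := c0_pos ha hγ P.d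
  set C' : ℝ := A * D / (P.R * Real.log (P.L : ℝ)) with hC'
  have hC'0 : 0 ≤ C' := by rw [hC']; positivity
  obtain ⟨x₀, hx₀1, hx₀⟩ := coeff354_threshold (d := P.d) hc hb hC'0 hR.le hpr
  refine ⟨min 1 (Real.exp (1 - x₀)), lt_min zero_lt_one (Real.exp_pos _), fun ε₀ hε₀ hε₀1 => ⟨B, ?_⟩⟩
  intro i hε hεle hstop
  have hε₀one : ε₀ ≤ 1 := le_trans hε₀1 (min_le_left _ _)
  have hK1 : epsK P (fam ε₀ i) (fam ε₀ i).K ≤ 1 := le_trans hstop.1 hε₀one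
  refine ineq342_of_leaves P (fam ε₀ i) (X ε₀ i) hL' hR hr hε hK1 hA hB hD (hT ε₀ i)
    (h347 ε₀ i hε hεle hstop) (h352 ε₀ i hε hεle hstop hε₀one) ?_
  intro k hk
  apply hx₀
  -- x_k ≥ 1 + log ε₀⁻¹ ≥ x₀
  have h1 : 1 + Real.log ε₀⁻¹ ≤ xk P (fam ε₀ i) k :=
    logScale_ge hL'.le hε hk hstop.1
  have h2 : x₀ ≤ 1 + Real.log ε₀⁻¹ := by
    have : Real.log ε₀ ≤ 1 - x₀ := by
      have := Real.log_le_log hε₀ (le_trans hε₀1 (min_le_right _ _))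
      rwa [Real.log_exp] at this
    rw [Real.log_inv]
    linarith
  exact le_trans h2 h1

/-- The same in the EQUALITY-ADMITTING form: if the constants already comply, `(A D/(R log L)) R^{d+1} ≤ c₀b₀²`, then
for `2p ≥ (d+1)r` the claim holds with threshold `ε₁ = 1` (at every scale `x_k ≥ 1`, so `x_k^{2p−(d+1)r} ≥ 1`) — the
reading under which the printed non-strict proviso is literally sufficient (cell GAPS.md G-pv04-2).
[folklore: cite: Balaban1982Higgs2, (3.54) p.594] -/
theorem claim342_of_leaves_of_const {I : Type} (P : Params) (fam : ℝ → I → Run) (X : ∀ ε₀ i, CData (fam ε₀ i))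
    {A B D : ℝ} (hP : P.Printed) (hr : 2 ≤ P.r) (hA : 0 ≤ A) (hB : 0 ≤ B) (hD : 0 ≤ D)
    (hconst : A * D / (P.R * Real.log (P.L : ℝ)) * P.R ^ (P.d + 1) ≤ c0 P.a P.γ₀ P.d * P.b₀ ^ 2)
    (hT : ∀ ε₀ i, (X ε₀ i).volTK ≤ (fam ε₀ i).volT)
    (h347 : ∀ ε₀ i, 0 < (fam ε₀ i).ε → (fam ε₀ i).ε ≤ ε₀ → (fam ε₀ i).StopsAt P ε₀ →
      Leaf347 P (fam ε₀ i) (X ε₀ i) A B)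
    (h352 : ∀ ε₀ i, 0 < (fam ε₀ i).ε → (fam ε₀ i).ε ≤ ε₀ → (fam ε₀ i).StopsAt P ε₀ → ε₀ ≤ 1 →
      Bound352 P (fam ε₀ i) (X ε₀ i) D) :
    Claim342Printed P fam := by
  intro hpr
  obtain ⟨_, _, hL, _, ha, hγ, hb, hR⟩ := hP
  have hL' : 1 < (P.L : ℝ) := by exact_mod_cast hL
  have hcb : 0 ≤ c0 P.a P.γ₀ P.d * P.b₀ ^ 2 := by
    have := c0_pos ha hγ P.d
    positivity
  refine ⟨1, zero_lt_one, fun ε₀ hε₀ hε₀1 => ⟨B, ?_⟩⟩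
  intro i hε hεle hstop
  have hK1 : epsK P (fam ε₀ i) (fam ε₀ i).K ≤ 1 := le_trans hstop.1 hε₀1
  refine ineq342_of_leaves P (fam ε₀ i) (X ε₀ i) hL' hR hr hε hK1 hA hB hD (hT ε₀ i)
    (h347 ε₀ i hε hεle hstop) (h352 ε₀ i hε hεle hstop hε₀1) ?_
  intro k hk
  have hx1 : 1 ≤ xk P (fam ε₀ i) k := one_le_xk P (fam ε₀ i) hL'.le hε hK1 hk.le
  have hδ : 0 ≤ 2 * P.p - ((P.d : ℝ) + 1) * P.r := by linarith
  have hpow : 1 ≤ xk P (fam ε₀ i) k ^ (2 * P.p - ((P.d : ℝ) + 1) * P.r) := Real.one_le_rpow hx1 hδ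
  calc A * D / (P.R * Real.log (P.L : ℝ)) * P.R ^ (P.d + 1) ≤ c0 P.a P.γ₀ P.d * P.b₀ ^ 2 := hconst
    _ = c0 P.a P.γ₀ P.d * P.b₀ ^ 2 * 1 := (mul_one _).symm
    _ ≤ c0 P.a P.γ₀ P.d * P.b₀ ^ 2 * xk P (fam ε₀ i) k ^ (2 * P.p - ((P.d : ℝ) + 1) * P.r) :=
        mul_le_mul_of_nonneg_left hpow hcb

/-- Family-level corollary with the leaf (3.50) in place of (3.52) (`D = (22·S351)ᵈ` by `bound352_of_350`), strict
case. [folklore: cite: Balaban1982Higgs2, Sect. 3.C pp.592–594] -/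
theorem claim342_of_leaves350 {I : Type} (P : Params) (fam : ℝ → I → Run) (X : ∀ ε₀ i, CData (fam ε₀ i))
    {A B : ℝ} (hP : P.Printed) (hr : 2 ≤ P.r) (hA : 0 ≤ A) (hB : 0 ≤ B)
    (hpr : ((P.d : ℝ) + 1) * P.r < 2 * P.p)
    (hT : ∀ ε₀ i, (X ε₀ i).volTK ≤ (fam ε₀ i).volT)
    (h347 : ∀ ε₀ i, 0 < (fam ε₀ i).ε → (fam ε₀ i).ε ≤ ε₀ → (fam ε₀ i).StopsAt P ε₀ →
      Leaf347 P (fam ε₀ i) (X ε₀ i) A B)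
    (h350 : ∀ ε₀ i, 0 < (fam ε₀ i).ε → (fam ε₀ i).ε ≤ ε₀ → (fam ε₀ i).StopsAt P ε₀ →
      Bound350 P (fam ε₀ i) (X ε₀ i)) :
    Claim342Printed P fam := by
  have hP' := hP
  obtain ⟨_, hr1, hL, _, _, _, _, hR⟩ := hP'
  have hL' : 1 < (P.L : ℝ) := by exact_mod_cast hL
  have hr0 : 0 ≤ P.r := by linarith
  have hD : 0 ≤ (22 * S351 (P.L : ℝ) P.r) ^ P.d := by
    have := one_le_S351 (r := P.r) hL'
    positivity
  refine claim342_of_leaves P fam X hP hr hA hB hD hpr hT h347 ?_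
  intro ε₀ i hε hεle hstop hε₀1
  exact bound352_of_350 P (fam ε₀ i) (X ε₀ i) hL' hR.le hr0 hε (le_trans hstop.1 hε₀1) (h350 ε₀ i hε hεle hstop)

end Literature.MathematicalPhysics.QuantumFieldTheory.Balaban1983to89.B2Sect3C
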